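import Literature.MathematicalPhysics.QuantumFieldTheory.WilsonTorusTransferGapExplicit
import Literature.MathematicalPhysics.QuantumFieldTheory.StrongCouplingActivities
import HarnessLib

/-!
# Route `BalabanLadder`, crux `IR` (stmt-QuantumFields-19354): the GAUSS-LAW FACTOR of Lüscher's transfer kernel
# CONCENTRATES — slice-independent mean by Haar invariance, Jensen's floor, Hoeffding's ceiling, and the cross-ratio
# diameter `Δ(𝕋) ≤ 9 n² β² L⁶` (part 1 of 2; part 2 = `BalabanLadderIRColdPurityGaussLawDecoupling.lean`)

Instrument seat `ym-ir-eng-2` (generation g6, transfer-matrix lane), cell `pub/ym-ir` (`--supports stmt-QuantumFields-19354`,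
helper; no registered stub is claimed).  Types the two refinements left open in `ym-ir-eng-4`'s PORTRAIT v2.6 §17 (C)
(«Jensen on the Gauss-law factor would halve c; a second-order (variance) version would give a β²L⁶ law — neither typed
here») of the slab-decoupling files `BalabanLadderIRColdPuritySlabChain/Decoupling.lean` (p629613/p630428), and of the
crude bounds `e^{−6nβL³} ≤ I ≤ 1`, `Δ(𝕋) ≤ 12nβL³` of `Literature/…/WilsonTorusTransferGapExplicit.lean` (lit-4).
THEOREMS ONLY — no `def`, no named fact, no `instance`.

THE OBJECT.  Slicing Wilson's theory (compact `G`, continuous unitary `n`-dimensional `ρ`, spatial torus `(ℤ/L)³`) across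
time, the one-step kernel is `K_β(U,V) = e^{−βS₃(U)/2}·I_β(U,V)·e^{−βS₃(V)/2}` (`wilsonSliceKernel`) with the GAUSS-LAW
FACTOR `I_β(U,V) = ∫ e^{−β S_tm(U,g,V)} ∏_x dg_x`, the temporal links `g : (ℤ/L)³ → G` integrated against the product Haar
probability measure, `S_tm(U,g,V) = Σ_{x,i} (n − Re tr ρ(g_x V_{x,i} g_{x+eᵢ}⁻¹ U_{x,i}⁻¹)) ∈ [0, 6nL³]` (`sliceTemporalAction`).

THE THEOREMS (all hypothesis-free, group-blind).
* §1 `integral_trace_re_plaquette_eq`, `integral_sliceTemporalAction_eq(_sum)`: for `L ≥ 2` the Haar AVERAGE of the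
  temporal plaquette energy does not see the slices — `∫ S_tm(U,g,V) dg = ∫ S_tm(U',g,V') dg =: S̄` for ALL `U, V, U', V'`.
  Proof: per plaquette, right translation of the product Haar measure by `V_{x,i}` at the site `x+eᵢ` and left
  translation by `U_{x,i}` at the site `x` (two DISTINCT sites when `L ≥ 2`) absorb both slice variables
  (`integral_mul_right_eq_self` / `integral_mul_left_eq_self` on the compact group `((ℤ/L)³ → G)`).
* §2 `exp_neg_mul_integral_le_gaussLaw` (JENSEN, Mathlib `ConvexOn.map_integral_le`): `e^{−βS̄} ≤ I_β(U,V)`;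
  `gaussLaw_le_exp_neg_mul_integral_mul_exp` (HOEFFDING's lemma, Mathlib `ProbabilityTheory.hasSubgaussianMGF_of_mem_Icc`
  for the `[0,6nL³]`-valued random variable `S_tm(U,·,V)` at the parameter `−β`): `I_β(U,V) ≤ e^{−βS̄}·e^{(9/2)n²β²L⁶}`.
  Both for every real `β`.
* §3 `wilsonSliceKernel_crossRatio_le_exp_sq`: the common factor `e^{−βS̄}` CANCELS in every `2 × 2` cross-ratio, so
  `K(U,V)K(U',V') ≤ e^{9n²β²L⁶}·K(U,V')K(U',V)` — the projective diameter of Lüscher's transfer matrix is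
  `Δ(𝕋) ≤ 9n²β²L⁶`, QUADRATIC in `β` (the first-order part `−βS̄` of `log I_β` is slice-independent), against the linear
  `12nβL³` of `WilsonTransferGapExplicit.wilsonSliceKernel_crossRatio_le`; smaller whenever `3nβ ≤ 4/L³`… i.e. on the
  whole small-`β` window where either is used.
Part 2 feeds §2 into eng-4's cut estimate (`Z(L³×t)² ≤ e^{9n²β²L⁶}Z(L³×2t)`, `coldDefect ≤ 9n²β²L⁶`, THE NUMBER at `L = 8`
for `β_W ≤ 1/7525` instead of `1/147456`) and §3 into Hopf's inequality (explicit finite-volume gap `tanh((9/4)n²β²L⁶)`).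

What is deliberately NOT here: the value of `S̄` (it is `3L³(n − dim ρ^G)`; only its slice-independence is used); the
sharper `L³`-law `Δ ≤ 18n²β²L³` (checkerboard independence of the site terms — a sequel); anything volume-uniform.
HONEST FRAMING: small-`β` bookkeeping for ONE finite torus, group-blind (`U(1)` obeys it verbatim), width 0 toward `PX` /
`PXcof` (β → ∞ objects); `BalabanLadder.IR` / `.IRcof` are NOT closed (0/1); the Yang–Mills mass gap (Clay) is NOT proved
by any of this; R4 closes only the conditional finite-𝕋⁴ rung `BalabanLadder.UV`.
-/

noncomputable section

open MeasureTheory Filter Function Set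
open Literature.MathematicalPhysics.QuantumFieldTheory

namespace Summit.QuantumFields.YangMills.Cruxes.IR.ColdPurityGaussLaw

/-! ## §0 Plumbing: distinct endpoints of a temporal plaquette; continuity and integrability on the temporal-link space -/

section Plumbing

variable {G : Type} [Group G] {n : ℕ} (ρ : G →* Matrix (Fin n) (Fin n) ℂ) {L : ℕ}

/-- On a spatial torus of side `L ≥ 2` the two endpoints `x`, `x + eᵢ` of a temporal plaquette are distinct sites
(`1 ≠ 0` in `ZMod L`); private copy of a lemma several tree files prove locally (e.g.
`TwistedTraceScaling.Negative.R11.shift_ne_self`), kept private to avoid an unrelated import. [folklore] -/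
private theorem shift_ne_self (hL : 2 ≤ L) (x : Site 3 L) (i : Fin 3) : x.shift i ≠ x := by
  haveI : Fact (1 < L) := ⟨hL⟩
  intro h
  have h1 := congr_fun h i
  simp only [Site.shift, Pi.add_apply, Pi.single_eq_same, add_eq_left] at h1
  exact one_ne_zero h1

/-- `|Re tr ρ(h)| ≤ n` for unitary `ρ`. [folklore] -/
theorem abs_trace_re_le (hρu : ∀ g, ρ g ∈ Matrix.unitaryGroup (Fin n) ℂ) (h : G) :
    |(ρ h).trace.re| ≤ n :=
  (Complex.abs_re_le_norm _).trans
    (Literature.Barriers.QuantumFields.FiniteTemperature.norm_trace_le_of_mem_unitaryGroup (hρu h))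

/-- `S_tm(U, g, V) ∈ [0, 6nL³]` (unitary `ρ`). [folklore] -/
theorem sliceTemporalAction_mem_Icc [NeZero L] (hρu : ∀ g, ρ g ∈ Matrix.unitaryGroup (Fin n) ℂ)
    (U V : GaugeConfig 3 L G) (g : Site 3 L → G) :
    sliceTemporalAction ρ U g V ∈ Icc (0 : ℝ) (6 * n * (L : ℝ) ^ 3) :=
  ⟨WilsonTransferGapExplicit.sliceTemporalAction_nonneg ρ hρu U g V,
    WilsonTransferGapExplicit.sliceTemporalAction_le ρ hρu U g V⟩

variable [TopologicalSpace G] [IsTopologicalGroup G]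

/-- Continuity of `g ↦ Re tr ρ(g_x · A · g_y⁻¹ · B)` on the temporal-link space (continuous `ρ`). [folklore] -/
theorem continuous_trace_re_plaquette (hρ : Continuous ρ) (x y : Site 3 L) (A B : G) :
    Continuous fun g : Site 3 L → G => (ρ (g x * A * (g y)⁻¹ * B)).trace.re := by
  have htr : Continuous fun g : G => (ρ g).trace.re :=
    Complex.continuous_re.comp (Continuous.matrix_trace hρ)
  exact htr.comp ((((continuous_apply x).mul continuous_const).mul (continuous_apply y).inv).mul
    continuous_const)

variable [MeasurableSpace G] [BorelSpace G] [SecondCountableTopology G] [NeZero L]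

/-- Measurability of `g ↦ S_tm(U, g, V)` (continuous `ρ`). [folklore] -/
theorem measurable_sliceTemporalAction (hρ : Continuous ρ) (U V : GaugeConfig 3 L G) :
    Measurable fun g : Site 3 L → G => sliceTemporalAction ρ U g V :=
  ((continuous_sliceTemporalAction ρ hρ).comp
    (continuous_const.prodMk (continuous_id.prodMk continuous_const))).measurable

variable [CompactSpace G]

/-- Integrability of `g ↦ Re tr ρ(g_x · A · g_y⁻¹ · B)` against the temporal-link Haar product (continuous and
bounded by `n` on a probability space). [folklore] -/
theorem integrable_trace_re_plaquette (hρ : Continuous ρ) (hρu : ∀ g, ρ g ∈ Matrix.unitaryGroup (Fin n) ℂ)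
    (x y : Site 3 L) (A B : G) :
    Integrable (fun g : Site 3 L → G => (ρ (g x * A * (g y)⁻¹ * B)).trace.re)
      (Measure.pi fun _ : Site 3 L => haarProbability G) :=
  Integrable.of_bound (continuous_trace_re_plaquette ρ hρ x y A B).measurable.aestronglyMeasurable n
    (Eventually.of_forall fun g => by rw [Real.norm_eq_abs]; exact abs_trace_re_le ρ hρu _)

/-- Integrability of `g ↦ S_tm(U, g, V)` against the temporal-link Haar product. [folklore] -/
theorem integrable_sliceTemporalAction (hρ : Continuous ρ) (hρu : ∀ g, ρ g ∈ Matrix.unitaryGroup (Fin n) ℂ)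
    (U V : GaugeConfig 3 L G) :
    Integrable (fun g : Site 3 L → G => sliceTemporalAction ρ U g V)
      (Measure.pi fun _ : Site 3 L => haarProbability G) :=
  Integrable.of_mem_Icc 0 (6 * n * (L : ℝ) ^ 3) (measurable_sliceTemporalAction ρ hρ U V).aemeasurable
    (Eventually.of_forall fun g => sliceTemporalAction_mem_Icc ρ hρu U V g)

/-- Integrability of `g ↦ exp(t · S_tm(U, g, V))` for every real `t`. [folklore] -/
theorem integrable_exp_mul_sliceTemporalAction (hρ : Continuous ρ) (hρu : ∀ g, ρ g ∈ Matrix.unitaryGroup (Fin n) ℂ)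
    (U V : GaugeConfig 3 L G) (t : ℝ) :
    Integrable (fun g : Site 3 L → G => Real.exp (t * sliceTemporalAction ρ U g V))
      (Measure.pi fun _ : Site 3 L => haarProbability G) :=
  ProbabilityTheory.integrable_exp_mul_of_mem_Icc (measurable_sliceTemporalAction ρ hρ U V).aemeasurable
    (Eventually.of_forall fun g => sliceTemporalAction_mem_Icc ρ hρu U V g)

end Plumbing

/-! ## §1 Haar invariance: the Gauss-law average of the temporal plaquette energy does not see the slices -/

section Invariance

variable {G : Type} [Group G] [TopologicalSpace G] [IsTopologicalGroup G] [CompactSpace G]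
  [MeasurableSpace G] [BorelSpace G] {n : ℕ} (ρ : G →* Matrix (Fin n) (Fin n) ℂ) {L : ℕ} [NeZero L]

/-- **Haar invariance of the Gauss-law average of one temporal plaquette**: for distinct sites `x ≠ y` and any
`A B : G`, `∫ Re tr ρ(g_x · A · g_y⁻¹ · B) ∏ dg = ∫ Re tr ρ(g_x · g_y⁻¹) ∏ dg` — right translation by `A` at `y` and
left translation by `B⁻¹` at `x` of the product Haar measure absorb both slices. [folklore] -/
theorem integral_trace_re_plaquette_eq {x y : Site 3 L} (hxy : x ≠ y) (A B : G) :
    ∫ g : Site 3 L → G, (ρ (g x * A * (g y)⁻¹ * B)).trace.re ∂(Measure.pi fun _ => haarProbability G) =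
      ∫ g : Site 3 L → G, (ρ (g x * (g y)⁻¹)).trace.re ∂(Measure.pi fun _ => haarProbability G) := by
  classical
  set μ : Measure (Site 3 L → G) := Measure.pi fun _ => haarProbability G with hμ
  -- step 1: right-translate by `r`, `r y = A`, `r z = 1` otherwise
  set r : Site 3 L → G := Function.update 1 y A with hr
  have hrx : r x = 1 := by rw [hr, Function.update_of_ne hxy, Pi.one_apply]
  have hry : r y = A := by rw [hr, Function.update_self]
  have h1 : ∫ g, (ρ (g x * A * (g y)⁻¹ * B)).trace.re ∂μ = ∫ g, (ρ (g x * (g y)⁻¹ * B)).trace.re ∂μ := by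
    have h := integral_mul_right_eq_self (μ := μ) (fun g : Site 3 L → G => (ρ (g x * A * (g y)⁻¹ * B)).trace.re) r
    rw [← h]
    refine integral_congr_ae (Eventually.of_forall fun g => ?_)
    simp only [Pi.mul_apply, hrx, hry, mul_one, mul_inv_rev]
    congr 4
    group
  -- step 2: cyclicity of the trace, then left-translate by `l`, `l x = B⁻¹`, `l z = 1` otherwise
  set l : Site 3 L → G := Function.update 1 x B⁻¹ with hl
  have hlx : l x = B⁻¹ := by rw [hl, Function.update_self]
  have hly : l y = 1 := by rw [hl, Function.update_of_ne (Ne.symm hxy), Pi.one_apply]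
  have h2 : ∫ g, (ρ (g x * (g y)⁻¹ * B)).trace.re ∂μ = ∫ g, (ρ (B * g x * (g y)⁻¹)).trace.re ∂μ := by
    refine integral_congr_ae (Eventually.of_forall fun g => ?_)
    simp only [map_mul]
    rw [Matrix.trace_mul_comm, ← mul_assoc]
  have h3 : ∫ g, (ρ (B * g x * (g y)⁻¹)).trace.re ∂μ = ∫ g, (ρ (g x * (g y)⁻¹)).trace.re ∂μ := by
    have h := integral_mul_left_eq_self (μ := μ) (fun g : Site 3 L → G => (ρ (B * g x * (g y)⁻¹)).trace.re) l
    rw [← h]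
    refine integral_congr_ae (Eventually.of_forall fun g => ?_)
    simp only [Pi.mul_apply, hlx, hly, one_mul]
    congr 4
    group
  rw [h1, h2, h3]

variable [SecondCountableTopology G]

/-- **The Gauss-law average of the temporal plaquette energy is a sum over plaquettes of slice-free Haar integrals**:
for `L ≥ 2`, continuous unitary `ρ` and ALL slices `U, V`,
`∫ S_tm(U, g, V) ∏ dg = Σ_{x, i} (n − ∫ Re tr ρ(g_x g_{x+eᵢ}⁻¹) ∏ dg)`. [folklore] -/
theorem integral_sliceTemporalAction_eq_sum (hρ : Continuous ρ) (hρu : ∀ g, ρ g ∈ Matrix.unitaryGroup (Fin n) ℂ)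
    (hL : 2 ≤ L) (U V : GaugeConfig 3 L G) :
    ∫ g : Site 3 L → G, sliceTemporalAction ρ U g V ∂(Measure.pi fun _ => haarProbability G) =
      ∑ x : Site 3 L, ∑ i : Fin 3, ((n : ℝ) -
        ∫ g : Site 3 L → G, (ρ (g x * (g (x.shift i))⁻¹)).trace.re ∂(Measure.pi fun _ => haarProbability G)) := by
  set μ : Measure (Site 3 L → G) := Measure.pi fun _ => haarProbability G with hμ
  have hint : ∀ (x : Site 3 L) (i : Fin 3), Integrable (fun g : Site 3 L → G =>
      (n : ℝ) - (ρ (g x * V (x, i) * (g (x.shift i))⁻¹ * (U (x, i))⁻¹)).trace.re) μ :=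
    fun x i => (integrable_const _).sub (integrable_trace_re_plaquette ρ hρ hρu x (x.shift i) _ _)
  unfold sliceTemporalAction
  rw [integral_finsetSum _ fun x _ => integrable_finsetSum _ fun i _ => hint x i]
  refine Finset.sum_congr rfl fun x _ => ?_
  rw [integral_finsetSum _ fun i _ => hint x i]
  refine Finset.sum_congr rfl fun i _ => ?_
  rw [integral_sub (integrable_const _) (integrable_trace_re_plaquette ρ hρ hρu x (x.shift i) _ _),
    integral_const, smul_eq_mul, probReal_univ, one_mul,
    integral_trace_re_plaquette_eq ρ (Ne.symm (shift_ne_self hL x i))]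

/-- **SLICE-INDEPENDENCE OF THE MEAN TEMPORAL ENERGY UNDER THE GAUSS LAW**: for `L ≥ 2`, continuous unitary `ρ`,
`∫ S_tm(U, g, V) ∏ dg = ∫ S_tm(U', g, V') ∏ dg` for all slices `U, V, U', V'`. [folklore] -/
theorem integral_sliceTemporalAction_eq (hρ : Continuous ρ) (hρu : ∀ g, ρ g ∈ Matrix.unitaryGroup (Fin n) ℂ)
    (hL : 2 ≤ L) (U V U' V' : GaugeConfig 3 L G) :
    ∫ g : Site 3 L → G, sliceTemporalAction ρ U g V ∂(Measure.pi fun _ => haarProbability G) =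
      ∫ g : Site 3 L → G, sliceTemporalAction ρ U' g V' ∂(Measure.pi fun _ => haarProbability G) := by
  rw [integral_sliceTemporalAction_eq_sum ρ hρ hρu hL, integral_sliceTemporalAction_eq_sum ρ hρ hρu hL]

end Invariance

/-! ## §2 Jensen's floor and Hoeffding's ceiling for the Gauss-law factor -/

section Concentration

variable {G : Type} [Group G] [TopologicalSpace G] [IsTopologicalGroup G] [CompactSpace G]
  [MeasurableSpace G] [BorelSpace G] [SecondCountableTopology G] {n : ℕ} (ρ : G →* Matrix (Fin n) (Fin n) ℂ)
  {L : ℕ} [NeZero L]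

/-- **Jensen's floor**: `exp(−β ∫ S_tm(U,g,V) dg) ≤ ∫ exp(−β S_tm(U,g,V)) dg` (any real `β`, continuous unitary `ρ`;
convexity of `exp` on the temporal-link probability space). [folklore] -/
theorem exp_neg_mul_integral_le_gaussLaw (hρ : Continuous ρ) (hρu : ∀ g, ρ g ∈ Matrix.unitaryGroup (Fin n) ℂ)
    (β : ℝ) (U V : GaugeConfig 3 L G) :
    Real.exp (-(β * ∫ g : Site 3 L → G, sliceTemporalAction ρ U g V ∂(Measure.pi fun _ => haarProbability G))) ≤
      ∫ g : Site 3 L → G, Real.exp (-(β * sliceTemporalAction ρ U g V))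
        ∂(Measure.pi fun _ => haarProbability G) := by
  set μ : Measure (Site 3 L → G) := Measure.pi fun _ => haarProbability G with hμ
  have hfi : Integrable (fun g : Site 3 L → G => -(β * sliceTemporalAction ρ U g V)) μ :=
    ((integrable_sliceTemporalAction ρ hρ hρu U V).const_mul β).neg
  have hgi : Integrable (Real.exp ∘ fun g : Site 3 L → G => -(β * sliceTemporalAction ρ U g V)) μ := by
    have h := integrable_exp_mul_sliceTemporalAction ρ hρ hρu U V (-β)
    refine h.congr (Eventually.of_forall fun g => ?_)
    simp only [comp_apply, neg_mul]
  have h := (convexOn_exp.map_integral_le Real.continuous_exp.continuousOn isClosed_univ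
    (Eventually.of_forall fun g => mem_univ _) hfi hgi)
  rw [integral_neg, integral_const_mul] at h
  exact h

/-- **Hoeffding's ceiling**: `∫ exp(−β S_tm(U,g,V)) dg ≤ exp(−β ∫ S_tm(U,g,V) dg) · exp((9/2) n² β² L⁶)` (any real `β`,
continuous unitary `ρ`): `S_tm(U, ·, V)` takes values in an interval of length `6nL³`, so by Hoeffding's lemma
(Mathlib `hasSubgaussianMGF_of_mem_Icc`) its centred moment generating function at `−β` is at most
`exp((3nL³)² β²/2)`. [folklore] -/
theorem gaussLaw_le_exp_neg_mul_integral_mul_exp (hρ : Continuous ρ) (hρu : ∀ g, ρ g ∈ Matrix.unitaryGroup (Fin n) ℂ)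
    (β : ℝ) (U V : GaugeConfig 3 L G) :
    ∫ g : Site 3 L → G, Real.exp (-(β * sliceTemporalAction ρ U g V)) ∂(Measure.pi fun _ => haarProbability G) ≤
      Real.exp (-(β * ∫ g : Site 3 L → G, sliceTemporalAction ρ U g V ∂(Measure.pi fun _ => haarProbability G))) *
        Real.exp (9 / 2 * (n : ℝ) ^ 2 * β ^ 2 * (L : ℝ) ^ 6) := by
  set μ : Measure (Site 3 L → G) := Measure.pi fun _ => haarProbability G with hμ
  set X : (Site 3 L → G) → ℝ := fun g => sliceTemporalAction ρ U g V with hX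
  have hsg := ProbabilityTheory.hasSubgaussianMGF_of_mem_Icc (μ := μ) (X := X) (a := 0)
    (b := 6 * n * (L : ℝ) ^ 3) (measurable_sliceTemporalAction ρ hρ U V).aemeasurable
    (Eventually.of_forall fun g => sliceTemporalAction_mem_Icc ρ hρu U V g)
  have hmgf := hsg.mgf_le (-β)
  -- the centred mgf at `-β`
  have hsplit : ∀ g, Real.exp (-(β * X g)) = Real.exp (-(β * ∫ g', X g' ∂μ)) * Real.exp ((-β) * (X g - ∫ g', X g' ∂μ)) :=
    fun g => by rw [← Real.exp_add]; congr 1; ring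
  have hI : ∫ g, Real.exp (-(β * X g)) ∂μ =
      Real.exp (-(β * ∫ g', X g' ∂μ)) * ∫ g, Real.exp ((-β) * (X g - ∫ g', X g' ∂μ)) ∂μ := by
    rw [← integral_const_mul]
    exact integral_congr_ae (Eventually.of_forall hsplit)
  rw [hI]
  refine mul_le_mul_of_nonneg_left ?_ (Real.exp_pos _).le
  have hc : (((‖(6 * n * (L : ℝ) ^ 3 : ℝ) - 0‖₊ / 2) ^ 2 : NNReal) : ℝ) * (-β) ^ 2 / 2 =
      9 / 2 * (n : ℝ) ^ 2 * β ^ 2 * (L : ℝ) ^ 6 := by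
    have h6 : (0 : ℝ) ≤ 6 * n * (L : ℝ) ^ 3 := by positivity
    rw [sub_zero, NNReal.coe_pow, NNReal.coe_div, coe_nnnorm, Real.norm_eq_abs, abs_of_nonneg h6]
    push_cast
    ring
  have h := hmgf
  rw [ProbabilityTheory.mgf, hc] at h
  exact h

end Concentration

/-! ## §3 The cross-ratio (projective) diameter of the Wilson time-slice kernel is at most `9n²β²L⁶` -/

section CrossRatio

variable {G : Type} [Group G] [TopologicalSpace G] [IsTopologicalGroup G] [CompactSpace G]
  [MeasurableSpace G] [BorelSpace G] [SecondCountableTopology G] {n : ℕ} (ρ : G →* Matrix (Fin n) (Fin n) ℂ)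
  {L : ℕ} [NeZero L]

/-- **THE CROSS-RATIO DIAMETER OF THE WILSON TIME-SLICE KERNEL IS AT MOST `9n²β²L⁶`**: for `L ≥ 2`, ANY real `β` and
continuous unitary `ρ`, `K(U,V)·K(U',V') ≤ e^{9n²β²L⁶}·K(U,V')·K(U',V)` — the half-weights `e^{−βS₃/2}` cancel, and the
four Gauss-law factors share the common factor `e^{−βS̄}` (`integral_sliceTemporalAction_eq`), which cancels too; what is
left is Hoeffding's fluctuation factor twice.  Compare `WilsonTransferGapExplicit.wilsonSliceKernel_crossRatio_le`
(`e^{12nβL³}`). [folklore] -/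
theorem wilsonSliceKernel_crossRatio_le_exp_sq (hρ : Continuous ρ) (hρu : ∀ g, ρ g ∈ Matrix.unitaryGroup (Fin n) ℂ)
    (hL : 2 ≤ L) (β : ℝ) (U U' V V' : GaugeConfig 3 L G) :
    wilsonSliceKernel ρ β U V * wilsonSliceKernel ρ β U' V' ≤
      Real.exp (9 * (n : ℝ) ^ 2 * β ^ 2 * (L : ℝ) ^ 6) * (wilsonSliceKernel ρ β U V' * wilsonSliceKernel ρ β U' V) := by
  set μ : Measure (Site 3 L → G) := Measure.pi fun _ => haarProbability G with hμ
  set Sbar : ℝ := ∫ g : Site 3 L → G, sliceTemporalAction ρ 1 g 1 ∂μ with hSbar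
  set c : ℝ := 9 / 2 * (n : ℝ) ^ 2 * β ^ 2 * (L : ℝ) ^ 6 with hc
  set I : GaugeConfig 3 L G → GaugeConfig 3 L G → ℝ :=
    fun U V => ∫ g, Real.exp (-(β * sliceTemporalAction ρ U g V)) ∂μ with hI
  have hIlo : ∀ U V, Real.exp (-(β * Sbar)) ≤ I U V := fun U V => by
    have h := exp_neg_mul_integral_le_gaussLaw ρ hρ hρu β U V
    rwa [integral_sliceTemporalAction_eq ρ hρ hρu hL U V 1 1] at h
  have hIhi : ∀ U V, I U V ≤ Real.exp (-(β * Sbar)) * Real.exp c := fun U V => by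
    have h := gaussLaw_le_exp_neg_mul_integral_mul_exp ρ hρ hρu β U V
    rwa [integral_sliceTemporalAction_eq ρ hρ hρu hL U V 1 1] at h
  have hI0 : ∀ U V, 0 ≤ I U V := fun U V => integral_nonneg fun g => (Real.exp_pos _).le
  set α : GaugeConfig 3 L G → ℝ := fun U => Real.exp (-(β * wilsonAction ρ U / 2)) with hα
  have hα0 : ∀ U, 0 ≤ α U := fun U => (Real.exp_pos _).le
  have hK : ∀ U V, wilsonSliceKernel ρ β U V = α U * I U V * α V := fun U V => rfl
  have he2 : Real.exp (9 * (n : ℝ) ^ 2 * β ^ 2 * (L : ℝ) ^ 6) = Real.exp c * Real.exp c := by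
    rw [← Real.exp_add, hc]; congr 1; ring
  have he : Real.exp (9 * (n : ℝ) ^ 2 * β ^ 2 * (L : ℝ) ^ 6) * (Real.exp (-(β * Sbar)) * Real.exp (-(β * Sbar))) =
      (Real.exp (-(β * Sbar)) * Real.exp c) * (Real.exp (-(β * Sbar)) * Real.exp c) := by
    rw [he2]; ring
  have hII : I U V * I U' V' ≤ Real.exp (9 * (n : ℝ) ^ 2 * β ^ 2 * (L : ℝ) ^ 6) * (I U V' * I U' V) :=
    calc I U V * I U' V' ≤ (Real.exp (-(β * Sbar)) * Real.exp c) * (Real.exp (-(β * Sbar)) * Real.exp c) :=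
          mul_le_mul (hIhi U V) (hIhi U' V') (hI0 U' V') (by positivity)
      _ = Real.exp (9 * (n : ℝ) ^ 2 * β ^ 2 * (L : ℝ) ^ 6) * (Real.exp (-(β * Sbar)) * Real.exp (-(β * Sbar))) := he.symm
      _ ≤ Real.exp (9 * (n : ℝ) ^ 2 * β ^ 2 * (L : ℝ) ^ 6) * (I U V' * I U' V) :=
          mul_le_mul_of_nonneg_left (mul_le_mul (hIlo U V') (hIlo U' V) (Real.exp_pos _).le (hI0 U V'))
            (Real.exp_pos _).le
  have hP : 0 ≤ α U * α V * α U' * α V' := by positivity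
  rw [hK U V, hK U' V', hK U V', hK U' V]
  calc α U * I U V * α V * (α U' * I U' V' * α V') = (α U * α V * α U' * α V') * (I U V * I U' V') := by ring
    _ ≤ (α U * α V * α U' * α V') * (Real.exp (9 * (n : ℝ) ^ 2 * β ^ 2 * (L : ℝ) ^ 6) * (I U V' * I U' V)) :=
        mul_le_mul_of_nonneg_left hII hP
    _ = Real.exp (9 * (n : ℝ) ^ 2 * β ^ 2 * (L : ℝ) ^ 6) * (α U * I U V' * α V' * (α U' * I U' V * α V)) := by ring

end CrossRatio

end Summit.QuantumFields.YangMills.Cruxes.IR.ColdPurityGaussLaw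

end
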